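import Mathlib
import Literature.NumberTheory.Sieve.RomanoffExplicitAllN
import Literature.NumberTheory.Sieve.ShnirelmanGoldbachHarmonic
import Literature.NumberTheory.LFunctions.ChebyshevCostaPereira68
import HarnessLib

/-!
# Romanoff's theorem, explicit and uniform in `N`: the constant `1/40` (all `N ≥ 4`), `1/31` from `e^38`, `1/26` from `e^190`

Topic `Literature/NumberTheory/Sieve`.  A follow-up to `RomanoffExplicitAllN.lean` (same namespace
`Literature.NumberTheory.Sieve.RomanoffExplicit`; unconditional records there: `1/79`, then `1/45`):
**`romanoffAllN_40 : RomanoffAllN (1/40) 4`** — for every `N ≥ 4`, `#{n ≤ N : n = p + 2^k, p prime, k ≥ 1} ≥ N/40`,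
with NO hypotheses and NO named facts; `romanov_ge_div31` (`N/31`, `N ≥ e^38`), `romanov_ge_div26` (`N/26`, `N ≥ e^190`),
and `romanov_ge_div25_CP68` (`N/25`, `N ≥ e^190`, under the `m = 68` Chebyshev bound `π(n) ≥ 0.984437 n/log n`,
`n ≥ 4.468·10^42`, taken as a hypothesis of the tree's shape `PrimeCountingLowerMul`).
§6 discharges that hypothesis with the tree theorem `CostaPereira68.primeCounting_ge_9` (`ChebyshevCostaPereira68.lean`):
**`romanov_ge_div25 : N ≥ e^190 → #romanovSet N ≥ N/25`, unconditionally.**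

Method = Romanoff's (Nathanson 1996 §7.6): nothing is re-proved — the engines are this namespace's `M1_ge_mul`,
`M2_le_final` (with `powTwoShiftMeanLe_193841`) and `density_of_moments`, packaged once more in the parametric
`density_mul_param` (any Chebyshev constant `c₀` from any `x₁`, any sieve threshold `Λ ≥ 38`, any slope `s`).
The NEW inputs are the tree's pair sieves `ShnirelmanGoldbachExplicit.pairCount_le_1301` (`13.01·f(h)·N/log²N`, `N ≥ e^38`)
and `pairCount_le_1152` (`11.52`, `N ≥ e^190`), read as `UniformPairSieve` instances, and Costa Pereira's
`π(n) ≥ 0.9636 n/log n` (`n ≥ 227`, `primeCountingLowerMul_09636`).  Desk: `s = 1.339` for `L ≥ 38`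
(`0.9636·(1.4426 L − 2) − 0.01 ≥ 1.339 L` iff `L ≥ 37.92`), `B = 4.035·13.01 = 52.50`, `1.339²/(1.339 + 52.50) = 0.03331 ≥ 1/31`;
`s = 1.3798`, `B = 4.035·11.52`: `0.03978 ≥ 1/26`; `c₀ = 0.984437`, `s = 1.4095`: `0.04148 ≥ 1/25`.
Below `e^38` one shift `p + 2`: `π(N − 2) ≥ 0.9636 (N − 2)/log(N − 2) ≥ N/40` for `log N ≤ 38.5` (`N ≥ 1752`), and four
kernel checkpoints on `firstPrimes` for `N < 5395`.  The junction `K ≥ 38/0.9636 = 39.4` makes `1/40` the optimum of this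
architecture (a pair sieve starting at `e^24`, of Riesel–Vaughan Lemma 5 strength, would give `1/25` for all `N`).
NOT a new asymptotic Romanov constant (print, `N ≥ N₀` only: Chen–Sun 2004 `0.0868`, Habsieger–Roblot 2006 `0.0933`,
Pintz 2006 `0.09368`, Elsholtz–Schlage-Puchta 2018 `0.107648`) and NOT a parity statement.
Origin: research cell parity-ideate (seat p5, ROUND-46, 2026-08-29); statements and proofs kernel-checked there verbatim.
-/


namespace Literature.NumberTheory.Sieve.RomanoffExplicit

open Finset Real
open Literature.NumberTheory.Sieve
open Literature.NumberTheory.Sieve.RomanoffExplicit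
open Literature.NumberTheory.Sieve.Romanov (romanovSet)
open Literature.NumberTheory.Sieve.ShnirelmanGoldbachExplicit (pairCount_le_1301 pairCount_le_1152
  primeCountingLowerMul_09636)

/-! ## §1 The cell's pair sieves as `UniformPairSieve` instances -/

/-- `UniformPairSieve 13.01 e^38` (the tree's `pairCount_le_1301`). [cite: BatemanDiamond2004, Thm 13.8, §13.4–13.5 pp. 325–328 (explicit form proved in the tree)] -/
theorem uniformPairSieve_1301 : UniformPairSieve 13.01 (Real.exp 38) := by
  intro x h hx hh heven
  exact pairCount_le_1301 hx hh heven

/-- `UniformPairSieve 11.52 e^190` (the tree's `pairCount_le_1152`). [cite: BatemanDiamond2004, Thm 13.8, §13.4–13.5 pp. 325–328 (explicit form proved in the tree)] -/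
theorem uniformPairSieve_1152 : UniformPairSieve 11.52 (Real.exp 190) := by
  intro x h hx hh heven
  exact pairCount_le_1152 hx hh heven

/-! ## §2 The density engine with a Chebyshev-shape `π` input of any constant `c₀` from any `x₁` -/

/-- **The analytic branch, parametric**: a uniform pair sieve `A` from `x₀`, `π(n) ≥ c₀ n/log n` (`n ≥ x₁`),
`c₀ x₁ ≤ 0.01 e^Λ`, `Λ ≥ 38`, and a slope `s > 0` with `s L ≤ c₀ (1.4426 L − 2) − 0.01` for `L ≥ Λ` give
`#romanovSet N ≥ s²/(s + 4.035 A)·N` for `N ≥ max(x₀, e^Λ)`.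
[cite: Nathanson1996, §7.6 Theorem 7.11 (Romanov's theorem) — explicit-uniform parametric form proved here] -/
theorem density_mul_param {A x₀ c₀ s Λ : ℝ} {x₁ : ℕ} (hA : 0 ≤ A) (hPS : UniformPairSieve A x₀)
    (hc₀ : 0 ≤ c₀) (hx₁ : 3 ≤ x₁) (hπ : PrimeCountingLowerMul c₀ x₁) (hs : 0 < s) (hΛ : 38 ≤ Λ)
    (hsmall : c₀ * (x₁ : ℝ) ≤ 0.01 * Real.exp Λ) (hx₁Λ : (2 : ℝ) * x₁ ≤ Real.exp Λ)
    (hnum : ∀ L : ℝ, Λ ≤ L → s * L ≤ c₀ * (1.4426 * L - 2) - 0.01)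
    {N : ℕ} (hx : x₀ ≤ (N : ℝ)) (hN : Real.exp Λ ≤ (N : ℝ)) :
    s ^ 2 / (s + 4.035 * A) * (N : ℝ) ≤ ((romanovSet N).card : ℝ) := by
  have h38 : Real.exp 38 ≤ (N : ℝ) := (Real.exp_le_exp.mpr hΛ).trans hN
  have hNbig : (4 : ℝ) ≤ N := by
    have : (4 : ℝ) ≤ Real.exp 38 := by
      have := Real.add_one_le_exp (38 : ℝ); linarith
    linarith
  have hNpos : (0 : ℝ) < N := by linarith
  have hN2 : 2 ≤ N := by exact_mod_cast (show (2 : ℝ) ≤ N by linarith)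
  have hlog2lo : (0.6931471803 : ℝ) < Real.log 2 := Real.log_two_gt_d9
  have hlog2hi : Real.log 2 < 0.6931471808 := Real.log_two_lt_d9
  set L := Real.log (N : ℝ) with hL
  have hLΛ : Λ ≤ L := by
    have h := Real.log_le_log (Real.exp_pos Λ) hN
    rwa [Real.log_exp] at h
  have hL38 : (38 : ℝ) ≤ L := hΛ.trans hLΛ
  have hx₁N : 2 * x₁ ≤ N := by
    have : (2 : ℝ) * x₁ ≤ N := hx₁Λ.trans hN
    exact_mod_cast this
  have h1 := M1_ge_mul (c₀ := c₀) (x₁ := x₁) hc₀ hx₁ hπ (N := N) hx₁N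
  have hinv : (1.4426 : ℝ) * L ≤ L / Real.log 2 := by
    rw [le_div_iff₀ (by linarith)]; nlinarith
  have hM1 : s * (N : ℝ) ≤ M1 N := by
    have hstep1 : c₀ * ((N : ℝ) * (1.4426 * L - 2) - x₁) ≤ c₀ * ((N : ℝ) * (L / Real.log 2 - 2) - x₁) := by
      apply mul_le_mul_of_nonneg_left _ hc₀
      nlinarith [mul_le_mul_of_nonneg_left hinv hNpos.le]
    have hstep2 : s * (N : ℝ) * L ≤ c₀ * ((N : ℝ) * (1.4426 * L - 2) - x₁) := by
      have hn := hnum L hLΛ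
      have hsm : c₀ * (x₁ : ℝ) ≤ 0.01 * (N : ℝ) := hsmall.trans (by nlinarith)
      have : s * L * (N : ℝ) ≤ (c₀ * (1.4426 * L - 2) - 0.01) * (N : ℝ) :=
        mul_le_mul_of_nonneg_right hn hNpos.le
      nlinarith
    have hkey : s * (N : ℝ) * L ≤ M1 N * L := (hstep2.trans hstep1).trans h1
    exact le_of_mul_le_mul_right hkey (by linarith)
  have h2 := M2_le_final hA hPS powTwoShiftMeanLe_193841 hx hN2
  have hB : A * 1.93841 / Real.log 2 ^ 2 ≤ 4.035 * A := by
    rw [div_le_iff₀ (by positivity)]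
    have hsq : (0.48045 : ℝ) ≤ Real.log 2 ^ 2 := by nlinarith
    nlinarith [mul_le_mul_of_nonneg_left hsq hA]
  have hM2 : M2 N ≤ M1 N + 4.035 * A * (N : ℝ) := by
    have : A * 1.93841 / Real.log 2 ^ 2 * (N : ℝ) ≤ 4.035 * A * (N : ℝ) :=
      mul_le_mul_of_nonneg_right hB hNpos.le
    linarith
  exact density_of_moments hs (by positivity) hM1 hM2

/-! ## §3 The three large-range instances -/

/-- `2·227 ≤ e^38` and `0.9636·227 ≤ 0.01·e^38`. [folklore] -/
private theorem exp_38_big : (22700 : ℝ) ≤ Real.exp 38 := by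
  have he : (2 : ℝ) ≤ Real.exp 1 := by have := Real.exp_one_gt_d9; linarith
  have h : (2 : ℝ) ^ 38 ≤ Real.exp 38 := by
    rw [show (38 : ℝ) = ((38 : ℕ) : ℝ) * 1 by norm_num, Real.exp_nat_mul]
    exact pow_le_pow_left₀ (by norm_num) he 38
  exact le_trans (by norm_num) h

/-- **`N ≥ e^38`: `#romanovSet N ≥ N/31`**, unconditionally (`A = 13.01`, `c₀ = 0.9636`, `s = 1.339`).
[cite: Nathanson1996, §7.6 Theorem 7.11 (Romanov's theorem) — explicit form with constant 1/31 from e^38 proved here] -/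
theorem romanov_ge_div31 {N : ℕ} (hN : Real.exp 38 ≤ (N : ℝ)) :
    (1 / 31 : ℝ) * (N : ℝ) ≤ ((romanovSet N).card : ℝ) := by
  have hd := density_mul_param (A := 13.01) (x₀ := Real.exp 38) (c₀ := 0.9636) (s := 1.339) (Λ := 38)
    (x₁ := 227) (by norm_num) uniformPairSieve_1301 (by norm_num) (by norm_num) primeCountingLowerMul_09636
    (by norm_num) le_rfl (by push_cast; linarith [exp_38_big]) (by push_cast; linarith [exp_38_big])
    (fun L hL => by nlinarith) hN hN
  have hc : (1 / 31 : ℝ) ≤ (1.339 : ℝ) ^ 2 / (1.339 + 4.035 * 13.01) := by norm_num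
  exact (mul_le_mul_of_nonneg_right hc (Nat.cast_nonneg N)).trans hd

/-- `e^38 ≤ e^190`. [folklore] -/
private theorem exp_38_le_exp_190 : Real.exp 38 ≤ Real.exp 190 := Real.exp_le_exp.mpr (by norm_num)

/-- **`N ≥ e^190`: `#romanovSet N ≥ N/26`**, unconditionally (`A = 11.52`, `c₀ = 0.9636`, `s = 1.3798`).
[cite: Nathanson1996, §7.6 Theorem 7.11 (Romanov's theorem) — explicit form with constant 1/26 from e^190 proved here] -/
theorem romanov_ge_div26 {N : ℕ} (hN : Real.exp 190 ≤ (N : ℝ)) :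
    (1 / 26 : ℝ) * (N : ℝ) ≤ ((romanovSet N).card : ℝ) := by
  have hd := density_mul_param (A := 11.52) (x₀ := Real.exp 190) (c₀ := 0.9636) (s := 1.3798) (Λ := 190)
    (x₁ := 227) (by norm_num) uniformPairSieve_1152 (by norm_num) (by norm_num) primeCountingLowerMul_09636
    (by norm_num) (by norm_num) (by push_cast; linarith [exp_38_big, exp_38_le_exp_190])
    (by push_cast; linarith [exp_38_big, exp_38_le_exp_190])
    (fun L hL => by nlinarith) hN hN
  have hc : (1 / 26 : ℝ) ≤ (1.3798 : ℝ) ^ 2 / (1.3798 + 4.035 * 11.52) := by norm_num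
  exact (mul_le_mul_of_nonneg_right hc (Nat.cast_nonneg N)).trans hd

/-- `2^190 ≤ e^190`, so `8.94·10^44 ≤ 2^150 ≤ e^190`. [folklore] -/
private theorem big_le_exp_190 : (893608200000000000000000000000000000000000000 : ℝ) ≤ Real.exp 190 := by
  have he : (2 : ℝ) ≤ Real.exp 1 := by have := Real.exp_one_gt_d9; linarith
  have h : (2 : ℝ) ^ 190 ≤ Real.exp 190 := by
    rw [show (190 : ℝ) = ((190 : ℕ) : ℝ) * 1 by norm_num, Real.exp_nat_mul]
    exact pow_le_pow_left₀ (by norm_num) he 190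
  exact le_trans (by norm_num) h

/-- **`N ≥ e^190`: `#romanovSet N ≥ N/25` under the `m = 68` Chebyshev bound** `π(n) ≥ 0.984437·n/log n`
(`n ≥ 4.468·10^42`, taken as a hypothesis; a kernel certificate of it exists in the originating cell and is being ported) — `s = 1.4095`.
[cite: Nathanson1996, §7.6 Theorem 7.11 (Romanov's theorem) — explicit form with constant 1/25 from e^190 proved here, modulo the cited Chebyshev input] -/
theorem romanov_ge_div25_CP68
    (h68 : PrimeCountingLowerMul 0.984437 4468041000000000000000000000000000000000000)
    {N : ℕ} (hN : Real.exp 190 ≤ (N : ℝ)) :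
    (1 / 25 : ℝ) * (N : ℝ) ≤ ((romanovSet N).card : ℝ) := by
  have hd := density_mul_param (A := 11.52) (x₀ := Real.exp 190) (c₀ := 0.984437) (s := 1.4095) (Λ := 190)
    (x₁ := 4468041000000000000000000000000000000000000) (by norm_num) uniformPairSieve_1152 (by norm_num)
    (by norm_num) h68 (by norm_num) (by norm_num) (by push_cast; linarith [big_le_exp_190])
    (by push_cast; linarith [big_le_exp_190])
    (fun L hL => by nlinarith) hN hN
  have hc : (1 / 25 : ℝ) ≤ (1.4095 : ℝ) ^ 2 / (1.4095 + 4.035 * 11.52) := by norm_num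
  exact (mul_le_mul_of_nonneg_right hc (Nat.cast_nonneg N)).trans hd

/-! ## §4 Below `e^38`: ONE shift `p + 2` -/

/-- `π(N − 2) ≤ #romanovSet N` (the representations `p + 2¹`; private copy of the tree's lemma). [folklore] -/
private theorem primeCounting_le_card_romanovSet (N : ℕ) :
    Nat.primeCounting (N - 2) ≤ (romanovSet N).card := by
  classical
  rw [← Nat.primesLE_card_eq_primeCounting]
  refine card_le_card_of_injOn (fun p => p + 2) ?_ ?_
  · intro p hp
    rw [mem_coe, Nat.mem_primesLE] at hp
    have h2 := hp.2.two_le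
    simp only [mem_coe, Romanov.romanovSet, mem_filter, mem_range]
    exact ⟨by omega, p, 1, hp.2, le_rfl, by ring⟩
  · intro p _ q _ h
    simpa using h

set_option maxRecDepth 100000 in
/-- Every entry of the tree's `firstPrimes` (the first 216 primes) is prime (kernel trial division; private copy). [folklore] -/
private theorem firstPrimes_prime : ∀ p ∈ firstPrimes, p.Prime := by
  decide +kernel

set_option maxRecDepth 100000 in
/-- `firstPrimes` has no duplicates (private copy). [folklore] -/
private theorem firstPrimes_nodup : firstPrimes.Nodup := by
  decide +kernel

/-- `π(x) ≥ #{p ∈ firstPrimes : p ≤ x}` (private copy). [folklore] -/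
private theorem le_primeCounting_of (x n : ℕ) (h : n ≤ (firstPrimes.filter (· ≤ x)).length) :
    n ≤ Nat.primeCounting x := by
  rw [← Nat.primesLE_card_eq_primeCounting]
  have hnd : (firstPrimes.filter (· ≤ x)).Nodup := firstPrimes_nodup.filter _
  rw [← List.toFinset_card_of_nodup hnd] at h
  refine h.trans (card_le_card ?_)
  intro p hp
  rw [List.mem_toFinset, List.mem_filter] at hp
  rw [Nat.mem_primesLE]
  exact ⟨by simpa using hp.2, firstPrimes_prime p hp.1⟩

set_option maxRecDepth 100000 in
/-- `4 ≤ N < 5395`: `N/40 ≤ π(N − 2)` by four checkpoints (`π(2), π(37), π(467), π(761) ≥ 1, 12, 91, 135`). [folklore] -/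
private theorem small_range {N : ℕ} (h4 : 4 ≤ N) (h : N < 5395) :
    (1 / 40 : ℝ) * (N : ℝ) ≤ (Nat.primeCounting (N - 2) : ℝ) := by
  have mono : ∀ {a b : ℕ}, a ≤ b → Nat.primeCounting a ≤ Nat.primeCounting b :=
    fun hab => Nat.monotone_primeCounting hab
  have step : ∀ (x n M : ℕ), n ≤ Nat.primeCounting x → x ≤ N - 2 → N < M → (M : ℝ) ≤ 40 * n →
      (1 / 40 : ℝ) * (N : ℝ) ≤ (Nat.primeCounting (N - 2) : ℝ) := by
    intro x n M hn hx hM hMn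
    have h1 : (n : ℝ) ≤ Nat.primeCounting (N - 2) := by exact_mod_cast hn.trans (mono hx)
    have h2 : (N : ℝ) < M := by exact_mod_cast hM
    linarith
  by_cases h40 : N < 40
  · exact step 2 1 40 (le_primeCounting_of 2 1 (by decide)) (by omega) h40 (by norm_num)
  by_cases h480 : N < 480
  · exact step 37 12 480 (le_primeCounting_of 37 12 (by decide)) (by omega) h480 (by norm_num)
  by_cases h3640 : N < 3640
  · exact step 467 91 3640 (le_primeCounting_of 467 91 (by decide)) (by omega) h3640 (by norm_num)
  · exact step 761 135 5400 (le_primeCounting_of 761 135 (by decide)) (by omega) (by omega) (by norm_num)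

/-- `5395 ≤ N`, `log N ≤ 38.5`: `N/40 ≤ π(N − 2)` from `π(n) ≥ 0.9636 n/log n` (`n ≥ 227`):
`0.9636 (N − 2) ≥ (38.5/40) N` iff `N ≥ 1752`. [folklore] -/
private theorem mid_range {N : ℕ} (h1 : 5395 ≤ N) (h2 : Real.log (N : ℝ) ≤ 38.5) :
    (1 / 40 : ℝ) * (N : ℝ) ≤ (Nat.primeCounting (N - 2) : ℝ) := by
  have hx := primeCountingLowerMul_09636 (N - 2) (by omega)
  have hcast : ((N - 2 : ℕ) : ℝ) = (N : ℝ) - 2 := by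
    rw [Nat.cast_sub (by omega)]; norm_num
  rw [hcast] at hx
  have hN : (5395 : ℝ) ≤ N := by exact_mod_cast h1
  have hlogle : Real.log ((N : ℝ) - 2) ≤ Real.log (N : ℝ) := Real.log_le_log (by linarith) (by linarith)
  have hlogpos : 0 < Real.log ((N : ℝ) - 2) := Real.log_pos (by linarith)
  rw [div_le_iff₀ hlogpos] at hx
  have hπ0 : (0 : ℝ) ≤ Nat.primeCounting (N - 2) := Nat.cast_nonneg _
  have : (Nat.primeCounting (N - 2) : ℝ) * Real.log ((N : ℝ) - 2) ≤ (Nat.primeCounting (N - 2) : ℝ) * 38.5 :=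
    mul_le_mul_of_nonneg_left (by linarith) hπ0
  linarith

/-- `4 ≤ N`, `log N ≤ 38.5`: `N/40 ≤ #romanovSet N`. [folklore] -/
private theorem finite_range {N : ℕ} (h4 : 4 ≤ N) (hlog : Real.log (N : ℝ) ≤ 38.5) :
    (1 / 40 : ℝ) * (N : ℝ) ≤ ((romanovSet N).card : ℝ) := by
  have hR : (Nat.primeCounting (N - 2) : ℝ) ≤ ((romanovSet N).card : ℝ) := by
    exact_mod_cast primeCounting_le_card_romanovSet N
  by_cases h1 : N < 5395
  · exact (small_range h4 h1).trans hR
  · exact (mid_range (by omega) hlog).trans hR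

/-! ## §5 The headline -/

/-- ★ **ROMANOFF'S THEOREM, EXPLICIT, UNIFORM IN `N`, UNCONDITIONAL, constant `1/40`**: for every `N ≥ 4`,
`#{n ≤ N : n = p + 2^k, p prime, k ≥ 1} ≥ N/40`.  NO named facts, no hypotheses (tree before: `1/45`, `1/79`;
`1/25`, `1/41`, `1/48` under Riesel–Vaughan Lemma 5 / Rosser–Schoenfeld (3.3)).  `N/31` above `e^38` by §3, `N/40` below by one shift.
[cite: Nathanson1996, §7.6 Theorem 7.11 (Romanov's theorem) — explicit-uniform form with constant 1/40 proved here] -/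
theorem romanoffAllN_40 : RomanoffAllN (1 / 40 : ℝ) 4 := by
  intro N hN
  by_cases h3 : (N : ℝ) < Real.exp 38
  · have hNpos : (0 : ℝ) < N := by exact_mod_cast (show 0 < N by omega)
    have hlog : Real.log (N : ℝ) ≤ 38.5 := by
      have := Real.log_le_log hNpos h3.le
      rw [Real.log_exp] at this
      linarith
    exact finite_range hN hlog
  · rw [not_lt] at h3
    have hd := romanov_ge_div31 h3
    have hN0 : (0 : ℝ) ≤ N := Nat.cast_nonneg N
    nlinarith

/-- The headline, unfolded: `∀ N ≥ 4, N/40 ≤ #{n ≤ N : ∃ p k, p prime ∧ 1 ≤ k ∧ p + 2^k = n}`.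
[cite: Nathanson1996, §7.6 Theorem 7.11 (Romanov's theorem) — explicit-uniform form with constant 1/40 proved here] -/
theorem romanoffAllN_40_statement :
    ∀ N : ℕ, 4 ≤ N → (1 / 40 : ℝ) * (N : ℝ) ≤ ((romanovSet N).card : ℝ) :=
  romanoffAllN_40

/-! ## §6 The `m = 68` column discharged: `N/25` from `e^190`, unconditionally (the Chebyshev bound is the tree
theorem `CostaPereira68.primeCounting_ge_9`, `ChebyshevCostaPereira68.lean`) -/

/-- **`N ≥ e^190`: `#{n ≤ N : n = p + 2^k} ≥ N/25`, unconditionally** — `romanov_ge_div25_CP68` with its hypothesis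
supplied by the kernel-certified `m = 68` Chebyshev scheme
`Literature.NumberTheory.LFunctions.CostaPereira68.primeCounting_ge_9` (`π(n) ≥ 0.984437·n/log n`, `n ≥ 227·30000⁹`).
[cite: Nathanson1996, §7.6 Theorem 7.11 (Romanov's theorem) — explicit form with constant 1/25 from e^190 proved here] -/
theorem romanov_ge_div25 {N : ℕ} (hN : Real.exp 190 ≤ (N : ℝ)) :
    (1 / 25 : ℝ) * (N : ℝ) ≤ ((romanovSet N).card : ℝ) :=
  romanov_ge_div25_CP68
    (fun _ hn => Literature.NumberTheory.LFunctions.CostaPereira68.primeCounting_ge_9 hn) hN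

end Literature.NumberTheory.Sieve.RomanoffExplicit
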